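import Summits.ValiantsHypothesis.ValiantsHypothesis.Theorems.KPlusLogSqLawTropicalGradedWalkDomMGlue2
import Summits.ValiantsHypothesis.ValiantsHypothesis.Theorems.KPlusLogSqLawTropicalGradedWalkDomMGlue3
import Summits.ValiantsHypothesis.ValiantsHypothesis.Theorems.KPlusLogSqLawTropicalGradedWalkDomMGlue4
import Summits.ValiantsHypothesis.ValiantsHypothesis.Theorems.KPlusLogSqLawTropicalGradedWalkDomMGlue5
import Summits.ValiantsHypothesis.ValiantsHypothesis.Theorems.KPlusLogSqLawTropicalGradedWalkDomMGlue6

/-!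
# Route «KPlusLogSqLaw» — GRW-lite (all-`m` `K = 4` family), dominance certificate of the LAST PHASE `w = m` — glue, part 7: the dominance theorems

HONEST FRAMING.  Helper file of the chain `--supports` the crux `Summit.ValiantsHypothesis.ValiantsHypothesis.Theses.KPlusLogSqLaw.TropicalB`
(item `stmt-ValiantsHypothesis-19771`, route `KPlusLogSqLaw`; cell `pub-symmetroid`, seat val-sym-trop-p3 g15, 2026-08-29).  Nothing here bears on
`TropicalB` in its window, `WeakLifting`, the doors, `MatrixDescartes` or `VP ≠ VNP` (census-side construction).

CONTENT.  Assembly: `isDominant_MX` (deep excursions `(m, u, t)`, `1 ≤ t ≤ u < m`), `isDominant_MD` (diagonal states `(m, u, 0)`), `isDominant_MT` (top states `(m, m, t)`) via `TropicalCensus.isDominant_of_scaledPotential` at scale `6` with the potentials of `…PotM`, the presence lemmas of `…DomMGlue1` and the column lemmas of `…DomMGlue2`–`…DomMGlue6`.  With `isDominant_D/T/X/X1` (phases `w < m`) this makes EVERY state of the GRW-lite design kernel-dominant.  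
-/

set_option linter.dupNamespace false
set_option autoImplicit false

namespace Summit.ValiantsHypothesis.ValiantsHypothesis.Theorems.LacunarySymmetroidMatrixDescartes.TropicalCensus

namespace GradedWalk

open Summit.ValiantsHypothesis.ValiantsHypothesis.Theorems.MatrixDescartes.Negative

variable (n : ℕ)

/-- every DEEP EXCURSION `(m, u, t)`, `1 ≤ t ≤ u < m`, of the last phase of the GRW-lite design is dominant at its slope. -/
theorem isDominant_MX (u t : ℕ) (ht : 1 ≤ t) (htu : t ≤ u) (hun : u ≤ n) :
    IsDominant (dd n) (vv n) (ee n) (theta n (n + 1) u t) (cterm n (n + 1) u t) := by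
  rw [theta_MX n (by omega)]
  unfold cterm
  refine isDominant_of_scaledPotential (dd n) (vv n) (ee n) (thM n u t) (perm n (n + 1) u t) (lam n (n + 1) u t) 6 (by norm_num)
    (fun a => UMX n u t a)
    (fun b => 6 * (thM n u t * (dd n (lam n (n + 1) u t b) : ℤ) - vv n (perm n (n + 1) u t b) b (lam n (n + 1) u t b)) -
      UMX n u t (perm n (n + 1) u t b)) ?_ ?_ ?_
  · exact present_MX n u t htu hun
  · intro i; ring
  · intro a b l hp hne
    by_cases h1 : (b : ℕ) + t < u
    · exact slackMX_c2 n u t ht htu hun a b l hp hne h1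
    · by_cases h2 : (b : ℕ) < u
      · exact slackMX_c3 n u t ht htu hun a b l hp hne (by omega) h2
      · by_cases h3 : (b : ℕ) = u
        · exact slackMX_cc n u t ht htu hun a b l hp hne h3
        · exact slackMX_c1 n u t ht htu hun a b l hp hne (by omega)

/-- every DIAGONAL state `(m, u, 0)`, `u < m`, of the last phase is dominant at its slope. -/
theorem isDominant_MD (u : ℕ) (hun : u ≤ n) :
    IsDominant (dd n) (vv n) (ee n) (theta n (n + 1) u 0) (cterm n (n + 1) u 0) := by
  rw [theta_MX n (by omega)]
  unfold cterm
  refine isDominant_of_scaledPotential (dd n) (vv n) (ee n) (thM n u 0) (perm n (n + 1) u 0) (lam n (n + 1) u 0) 6 (by norm_num)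
    (fun a => UMD n u a)
    (fun b => 6 * (thM n u 0 * (dd n (lam n (n + 1) u 0 b) : ℤ) - vv n (perm n (n + 1) u 0 b) b (lam n (n + 1) u 0 b)) -
      UMD n u (perm n (n + 1) u 0 b)) ?_ ?_ ?_
  · exact present_MX n u 0 (Nat.zero_le _) hun
  · intro i; ring
  · intro a b l hp hne
    by_cases h1 : (b : ℕ) < u
    · exact slackMD_c2 n u hun a b l hp hne h1
    · exact slackMD_c1 n u hun a b l hp hne (by omega)

/-- every TOP state `(m, m, t)`, `t ≤ m`, of the last phase is dominant at its slope. -/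
theorem isDominant_MT (t : ℕ) (htn : t ≤ n + 1) :
    IsDominant (dd n) (vv n) (ee n) (theta n (n + 1) (n + 1) t) (cterm n (n + 1) (n + 1) t) := by
  rw [theta_MT n]
  unfold cterm
  refine isDominant_of_scaledPotential (dd n) (vv n) (ee n) (thMT n t) (perm n (n + 1) (n + 1) t) (lam n (n + 1) (n + 1) t) 6
    (by norm_num) (fun a => UMT n t a)
    (fun b => 6 * (thMT n t * (dd n (lam n (n + 1) (n + 1) t b) : ℤ) - vv n (perm n (n + 1) (n + 1) t b) b (lam n (n + 1) (n + 1) t b)) -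
      UMT n t (perm n (n + 1) (n + 1) t b)) ?_ ?_ ?_
  · exact present_MT n t
  · intro i; ring
  · intro a b l hp hne
    by_cases h1 : (b : ℕ) < t
    · exact slackMT_c3 n t htn a b l hp hne h1
    · exact slackMT_c2 n t htn a b l hp hne (by omega)

end GradedWalk

end Summit.ValiantsHypothesis.ValiantsHypothesis.Theorems.LacunarySymmetroidMatrixDescartes.TropicalCensus
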